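import Summits.AtomisticToContinuum.Crystallization.Theorems.ChartedZeroExcessLayeredLatticeLiouvilleZZZYRCXK

/-!
# ChartedZeroExcessLayeredLatticeLiouville · ZZZYRCXM — COMPLETENESS LEMMAS OF THE θ⁰ COUNT PROGRAM (RCXK §6)
(decomp-a2c hand-1 g54; target stmt-AtomisticToContinuum-26636 JS-D near reader; critic r1848 (B) count files «Theta<Word><Res>Count»)

§1 the BOX LEMMA `inBox_of_n9_le` (a site of ideal `n9 ≤ hi` lies in the scanned box under lens-2's side conditions `4·hi < 3(3GB+1)²`,
`hi < 6(MB+1)²`); §2 the window locator `slabIdx` read back (`= some s` ⇒ `cuts[s] < u9 ≤ cuts[s+1]`, `s + 1 < |cuts|`); §3 the counter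
`incrAt` (length preserved; entry `s` incremented, others unchanged).  §4 ★★ `getD_countWins`: entry `s` of `countWins` IS the number
of box offsets located in window `s` (generic `incrAt`-fold count + `flatMap` fold + `countWins` as one fold, by `rfl`).  §5 `u9N_eq`: the
program's ℕ `n9` IS the ideal signed `n9` of the site with offsets `(a, b, c)` (general offset identity `offset_n9_general`).  §6 the
PIGEONHOLE COVER `cover_of_card_eq(_map)` (duplicate-free, all inside, same cardinality ⇒ cover).  The assembly with the slab files'
`lastCodesStrict`/window facts (codes ↔ offsets) is the remaining step (hand-1 g55).  Imports RCXK; 0 sorry.  All `[folklore]`.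
-/

namespace Summit.AtomisticToContinuum.Crystallization.Theorems.ChartedZeroExcessLayeredLatticeLiouville.ThetaKernel

/-! ## §1 the box lemma -/

/-- `4·qhex(x, y) ≥ 3x²` (`4(x² + xy + y²) − 3x² = (x + 2y)²`). [folklore] -/
theorem three_sq_le_four_qhex (x y : ℤ) : 3 * (x * x) ≤ 4 * (x * x + x * y + y * y) := by
  nlinarith [sq_nonneg (x + 2 * y)]

/-- ★ THE BOX LEMMA: a far site `Y = (γ₀, γ₁, mX + Δm)` whose ideal `n9 = qhex(3γ₀ + d, 3γ₁ + d) + 6Δm²` (`d` = the letter difference,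
`|d| ≤ 2`) is at most `hi` lies in the box `|γ₀|, |γ₁| ≤ GB`, `|Δm| ≤ MB` as soon as `4·hi < 3(3GB+1)²` and `hi < 6(MB+1)²` (lens-2's
side conditions of `slabCheck`; the count file's `box_ok`). [folklore] -/
theorem inBox_of_n9_le (g0 g1 dm d hi : ℤ) (GB MB : ℕ) (hd : |d| ≤ 2)
    (h9 : (3 * g0 + d) * (3 * g0 + d) + (3 * g0 + d) * (3 * g1 + d) + (3 * g1 + d) * (3 * g1 + d) + 6 * dm * dm ≤ hi)
    (hGB : 4 * hi < 3 * (3 * (GB : ℤ) + 1) ^ 2) (hMB : hi < 6 * ((MB : ℤ) + 1) ^ 2) :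
    |g0| ≤ GB ∧ |g1| ≤ GB ∧ |dm| ≤ MB := by
  have hq0 := three_sq_le_four_qhex (3 * g0 + d) (3 * g1 + d)
  have hq1 := three_sq_le_four_qhex (3 * g1 + d) (3 * g0 + d)
  have hdm : 0 ≤ dm * dm := mul_self_nonneg dm
  have hqnn : 0 ≤ (3 * g0 + d) * (3 * g0 + d) + (3 * g0 + d) * (3 * g1 + d) + (3 * g1 + d) * (3 * g1 + d) := by
    nlinarith [sq_nonneg (2 * (3 * g0 + d) + (3 * g1 + d)), sq_nonneg (3 * g1 + d)]
  have hB : (0 : ℤ) ≤ 3 * (GB : ℤ) + 1 := by positivity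
  have hM : (0 : ℤ) ≤ (MB : ℤ) + 1 := by positivity
  have hx0 : (3 * g0 + d) ^ 2 < (3 * (GB : ℤ) + 1) ^ 2 := by nlinarith
  have hx1 : (3 * g1 + d) ^ 2 < (3 * (GB : ℤ) + 1) ^ 2 := by nlinarith
  have hz : dm ^ 2 < ((MB : ℤ) + 1) ^ 2 := by nlinarith
  have a0 := abs_lt_of_sq_lt_sq' hx0 hB
  have a1 := abs_lt_of_sq_lt_sq' hx1 hB
  have am := abs_lt_of_sq_lt_sq' hz hM
  rw [abs_le] at hd
  refine ⟨abs_le.mpr ⟨?_, ?_⟩, abs_le.mpr ⟨?_, ?_⟩, abs_le.mpr ⟨?_, ?_⟩⟩ <;> omega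

/-! ## §2 the window locator -/

/-- unfolding `slabIdx` on two or more cut points. [folklore] -/
theorem slabIdx_cons_cons (κ κ' : ℕ) (rest : List ℕ) (u9 : ℕ) :
    slabIdx (κ :: κ' :: rest) u9 =
      (bif Nat.ble u9 κ then none else bif Nat.ble u9 κ' then some 0 else (slabIdx (κ' :: rest) u9).map (· + 1)) := rfl

/-- ★ `slabIdx cuts u9 = some s` ⇒ window `s` exists and contains `u9`: `cuts[s] < u9 ≤ cuts[s+1]`. [folklore] -/
theorem slabIdx_some : ∀ (cuts : List ℕ) (u9 s : ℕ), slabIdx cuts u9 = some s →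
    s + 1 < cuts.length ∧ cuts.getD s 0 < u9 ∧ u9 ≤ cuts.getD (s + 1) 0
  | [], _, _, h => by simp [slabIdx] at h
  | [_], _, _, h => by simp [slabIdx] at h
  | κ :: κ' :: rest, u9, s, h => by
    rw [slabIdx_cons_cons] at h
    cases h1 : Nat.ble u9 κ with
    | true => rw [h1] at h; exact absurd h (by simp)
    | false =>
      rw [h1] at h
      simp only [cond_false] at h
      have hκ : κ < u9 := by
        by_contra hle
        have : Nat.ble u9 κ = true := Nat.ble_eq.mpr (by omega)
        rw [h1] at this; exact Bool.false_ne_true this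
      cases h2 : Nat.ble u9 κ' with
      | true =>
        rw [h2] at h
        simp only [cond_true, Option.some.injEq] at h
        subst h
        have hκ' : u9 ≤ κ' := Nat.ble_eq.mp h2
        exact ⟨by simp, by simpa using hκ, by simpa using hκ'⟩
      | false =>
        rw [h2] at h
        simp only [cond_false] at h
        cases h3 : slabIdx (κ' :: rest) u9 with
        | none => rw [h3] at h; exact absurd h (by simp)
        | some s' =>
          rw [h3] at h
          simp only [Option.map_some, Option.some.injEq] at h
          subst h
          obtain ⟨L, G1, G2⟩ := slabIdx_some (κ' :: rest) u9 s' h3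
          refine ⟨by simpa using L, ?_, ?_⟩
          · simpa [List.getD_cons_succ] using G1
          · simpa [List.getD_cons_succ] using G2

/-! ## §3 the counter -/

/-- `incrAt` preserves the length. [folklore] -/
theorem length_incrAt : ∀ (l : List ℕ) (s : ℕ), (incrAt l s).length = l.length
  | [], _ => rfl
  | _ :: _, 0 => rfl
  | _ :: rest, s + 1 => by simp [incrAt, length_incrAt rest s]

/-- `incrAt l s` adds one at position `s` (when `s < |l|`) and changes nothing else. [folklore] -/
theorem getD_incrAt : ∀ (l : List ℕ) (s i : ℕ),
    (incrAt l s).getD i 0 = l.getD i 0 + if i = s ∧ s < l.length then 1 else 0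
  | [], s, i => by simp [incrAt]
  | n :: rest, 0, 0 => by simp [incrAt]
  | n :: rest, 0, i + 1 => by simp [incrAt]
  | n :: rest, s + 1, 0 => by simp [incrAt]
  | n :: rest, s + 1, i + 1 => by
    simp only [incrAt, List.getD_cons_succ, getD_incrAt rest s i, List.length_cons]
    by_cases h : i = s ∧ s < rest.length
    · rw [if_pos h, if_pos (by omega)]
    · rw [if_neg h, if_neg (by omega)]

/-! ## §4 the fold-to-count identification -/

/-- ★ generic: folding `incrAt` at the located index counts, per index `s < |init|`, the elements located at `s`. [folklore] -/
theorem getD_foldl_incrAt {α : Type*} (idx : α → Option ℕ) : ∀ (L : List α) (init : List ℕ) (s : ℕ), s < init.length →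
    (L.foldl (fun counts x => match idx x with | none => counts | some s' => incrAt counts s') init).getD s 0 =
      init.getD s 0 + (L.filter fun x => idx x = some s).length
  | [], init, s, _ => by simp
  | x :: rest, init, s, hs => by
    rw [List.foldl_cons, List.filter_cons]
    cases hx : idx x with
    | none =>
      rw [getD_foldl_incrAt idx rest init s hs]
      simp
    | some s' =>
      simp only
      have hlen : s < (incrAt init s').length := by rw [length_incrAt]; exact hs
      rw [getD_foldl_incrAt idx rest (incrAt init s') s hlen, getD_incrAt]
      by_cases h : s = s'
      · subst h; simp [hs]; omega
      · have h' : ¬ (s' = s) := fun e => h e.symm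
        simp [h, h']

/-- folding over a `flatMap` = nested folds. [folklore] -/
theorem foldl_flatMap_eq {α β γ : Type*} (f : α → List β) (g : γ → β → γ) : ∀ (l : List α) (init : γ),
    (l.flatMap f).foldl g init = l.foldl (fun acc a => (f a).foldl g acc) init
  | [], _ => rfl
  | a :: rest, init => by rw [List.flatMap_cons, List.foldl_append, List.foldl_cons, foldl_flatMap_eq f g rest]

/-- the program's ℕ expression for `n9` of the box site with offsets `(a, b, c)`. -/
def u9N (w : List ℕ) (mX GB MB a b c : ℕ) : ℕ :=
  let p := w.length
  let ra := regN w p (600 + mX)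
  let K := 3 * GB + 3
  let rb := regN w p (600 + mX + c - MB)
  let x0 := 3 * a + 3 + rb - ra
  let x1 := 3 * b + 3 + rb - ra
  x0 * x0 + x0 * x1 + x1 * x1 + 3 * K * K + 6 * (c * c) + 6 * (MB * MB) - (3 * K * (x0 + x1) + 12 * MB * c)

/-- the scanned box offsets as ONE list of triples. -/
def boxTriples (GB MB : ℕ) : List (ℕ × ℕ × ℕ) :=
  (List.range (2 * GB + 1)).flatMap fun a => (List.range (2 * GB + 1)).flatMap fun b =>
    (List.range (2 * MB + 1)).map fun c => (a, b, c)

/-- `countWins` as a single fold over the box triples. [folklore] -/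
theorem countWins_eq_foldl (w : List ℕ) (mX GB MB : ℕ) (cuts : List ℕ) :
    countWins w mX GB MB cuts = (boxTriples GB MB).foldl (fun counts abc =>
      match slabIdx cuts (u9N w mX GB MB abc.1 abc.2.1 abc.2.2) with
      | none => counts
      | some s => incrAt counts s) (List.replicate (cuts.length - 1) 0) := by
  rw [boxTriples, foldl_flatMap_eq]
  unfold countWins
  simp only [foldl_flatMap_eq, List.foldl_map]
  rfl

/-- ★★ THE COUNT PROGRAM IS SOUND: entry `s` of `countWins` is the number of box offsets `(a, b, c)` whose `n9` lies in window `s`. [folklore] -/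
theorem getD_countWins (w : List ℕ) (mX GB MB : ℕ) (cuts : List ℕ) (s : ℕ) (hs : s + 1 < cuts.length) :
    (countWins w mX GB MB cuts).getD s 0 =
      ((boxTriples GB MB).filter fun abc => slabIdx cuts (u9N w mX GB MB abc.1 abc.2.1 abc.2.2) = some s).length := by
  rw [countWins_eq_foldl, getD_foldl_incrAt _ _ _ s (by simp; omega)]
  have h0 : (List.replicate (cuts.length - 1) 0).getD s 0 = 0 := by
    rw [List.getD_eq_getElem?_getD, List.getElem?_replicate]; split <;> rfl
  rw [h0, Nat.zero_add]

/-! ## §5 the signed reading of the count program's `n9` -/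

/-- general offset identity: with `x = v + K` (componentwise, `x₂ = v₂ + L`),
`x₀² + x₀x₁ + x₁² + 3K² + 6x₂² + 6L² − (3K(x₀ + x₁) + 12·L·x₂) = v₀² + v₀v₁ + v₁² + 6v₂²` (exact ℕ subtraction). [folklore] -/
theorem offset_n9_general (x0 x1 xm K L : ℕ) (v0 v1 vm : ℤ) (h0 : (x0 : ℤ) = v0 + K) (h1 : (x1 : ℤ) = v1 + K)
    (hm : (xm : ℤ) = vm + L) :
    ((x0 * x0 + x0 * x1 + x1 * x1 + 3 * K * K + 6 * (xm * xm) + 6 * (L * L) - (3 * K * (x0 + x1) + 12 * L * xm) : ℕ) : ℤ) =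
      v0 * v0 + v0 * v1 + v1 * v1 + 6 * vm * vm := by
  have hnn := n9_form_nonneg v0 v1 vm
  have hle : 3 * K * (x0 + x1) + 12 * L * xm ≤ x0 * x0 + x0 * x1 + x1 * x1 + 3 * K * K + 6 * (xm * xm) + 6 * (L * L) := by
    have : (3 * K * (x0 + x1) + 12 * L * xm : ℤ) ≤ x0 * x0 + x0 * x1 + x1 * x1 + 3 * K * K + 6 * (xm * xm) + 6 * (L * L) := by
      rw [h0, h1, hm]; nlinarith [hnn]
    exact_mod_cast this
  push_cast [Nat.cast_sub hle]
  rw [h0, h1, hm]; ring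

/-- ★ THE COUNT PROGRAM'S `n9` IS THE IDEAL `n9` of the far site with offsets `(a, b, c)`: `γ₀ = a − GB`, `γ₁ = b − GB`, `Δm = c − MB`,
letters `rb = regN w |w| (600 + mX + c − MB)` (layer of `Y`, shifted) and `ra = regN w |w| (600 + mX)` (layer of `X`), both `≤ 2`:
`u9N = (3γ₀ + (rb − ra))² + (3γ₀ + (rb − ra))(3γ₁ + (rb − ra)) + (3γ₁ + (rb − ra))² + 6Δm²`. [folklore] -/
theorem u9N_eq (w : List ℕ) (mX GB MB a b c : ℕ) (hw : ∀ x, regN w w.length x ≤ 2) :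
    ((u9N w mX GB MB a b c : ℕ) : ℤ) =
      let d : ℤ := (regN w w.length (600 + mX + c - MB) : ℤ) - regN w w.length (600 + mX)
      (3 * ((a : ℤ) - GB) + d) * (3 * ((a : ℤ) - GB) + d) + (3 * ((a : ℤ) - GB) + d) * (3 * ((b : ℤ) - GB) + d) +
        (3 * ((b : ℤ) - GB) + d) * (3 * ((b : ℤ) - GB) + d) + 6 * ((c : ℤ) - MB) * ((c : ℤ) - MB) := by
  have hra := hw (600 + mX)
  have hrb := hw (600 + mX + c - MB)
  unfold u9N
  simp only
  have hx0 : ((3 * a + 3 + regN w w.length (600 + mX + c - MB) - regN w w.length (600 + mX) : ℕ) : ℤ) =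
      (3 * ((a : ℤ) - GB) + ((regN w w.length (600 + mX + c - MB) : ℤ) - regN w w.length (600 + mX))) + ((3 * GB + 3 : ℕ) : ℤ) := by
    have hle : regN w w.length (600 + mX) ≤ 3 * a + 3 + regN w w.length (600 + mX + c - MB) := by omega
    push_cast [Nat.cast_sub hle]; ring
  have hx1 : ((3 * b + 3 + regN w w.length (600 + mX + c - MB) - regN w w.length (600 + mX) : ℕ) : ℤ) =
      (3 * ((b : ℤ) - GB) + ((regN w w.length (600 + mX + c - MB) : ℤ) - regN w w.length (600 + mX))) + ((3 * GB + 3 : ℕ) : ℤ) := by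
    have hle : regN w w.length (600 + mX) ≤ 3 * b + 3 + regN w w.length (600 + mX + c - MB) := by omega
    push_cast [Nat.cast_sub hle]; ring
  have hxm : ((c : ℕ) : ℤ) = ((c : ℤ) - MB) + ((MB : ℕ) : ℤ) := by ring
  rw [offset_n9_general _ _ _ (3 * GB + 3) MB _ _ _ hx0 hx1 hxm]

/-! ## §6 pigeonhole: count + distinct + all inside ⇒ cover -/

/-- ★ PIGEONHOLE COVER: a duplicate-free list whose elements all lie in a finite set of the SAME cardinality covers that set — the
completeness step «#chords of the slab = count of the window ∧ far sites distinct ∧ all in the window ⇒ every window site is a chord».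
[folklore] -/
theorem cover_of_card_eq {α : Type*} [DecidableEq α] (L : List α) (S : Finset α) (hnd : L.Nodup) (hin : ∀ x ∈ L, x ∈ S)
    (hcard : S.card = L.length) : ∀ s ∈ S, s ∈ L := by
  have hsub : L.toFinset ⊆ S := fun x hx => hin x (List.mem_toFinset.mp hx)
  have hc : L.toFinset.card = L.length := List.toFinset_card_of_nodup hnd
  have heq : L.toFinset = S := Finset.eq_of_subset_of_card_le hsub (by rw [hc, hcard])
  intro s hs
  rw [← heq] at hs
  exact List.mem_toFinset.mp hs

/-- the same through an injective key (chords are known by their far-site CODE, the window set by its OFFSETS): if `f` is injective on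
`L`, `L.map f` is duplicate-free, lands in `S`, and `|S| = |L|`, then every element of `S` is `f` of a list element. [folklore] -/
theorem cover_of_card_eq_map {α β : Type*} [DecidableEq β] (L : List α) (f : α → β) (S : Finset β) (hnd : (L.map f).Nodup)
    (hin : ∀ x ∈ L, f x ∈ S) (hcard : S.card = L.length) : ∀ s ∈ S, ∃ x ∈ L, f x = s := by
  intro s hs
  have h := cover_of_card_eq (L.map f) S hnd (fun y hy => by
    obtain ⟨x, hx, rfl⟩ := List.mem_map.mp hy; exact hin x hx) (by rw [List.length_map]; exact hcard) s hs
  obtain ⟨x, hx, hfx⟩ := List.mem_map.mp h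
  exact ⟨x, hx, hfx⟩


end Summit.AtomisticToContinuum.Crystallization.Theorems.ChartedZeroExcessLayeredLatticeLiouville.ThetaKernel
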